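import Summits.BirchSwinnertonDyer.Rank1Residual.Additive.QuadraticBranchOddStrictSelmerCertificate
import Summits.BirchSwinnertonDyer.Rank1Residual.Additive.StrictSelmerDominatesSha
import HarnessLib

/-!
# Odd `η`-branch consumers with the elementary input (P4) DISCHARGED: ONE typed input + two
# per-pair certificates + `r_an(W) = 1 ⟹ BSD(W, p)` (cell `b2b-bsdres`, lane CLASS-CLOSURE, seat
# cc-typer-6 GEN 7; receipt of n1011-p01's `StrictSha.strictSelmerDominatesShaAt_holds`, p263878)

HONEST FRAMING (cell `b2b-bsdres`, run/shared/lean/b2b/bsd-rank1-residual/, verbatim in every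
file): the goal of the cell is to DELETE the COMBINATION-SHAPED residual classes of the
Birch–Swinnerton-Dyer formula for ALL analytic-rank `≤ 1` elliptic curves over `ℚ` — "full BSD
formula for every rank `≤ 1` curve in class `C`" assembled STRICTLY from published theorems — so
that the rank-`≤ 1` remainder becomes exactly the CONSTRUCTION-SHAPED classes, which are TYPED
(missing-input `Prop`s), NOT attempted. This is not "finishing BSD". Lane CLASS-CLOSURE
(coordinator ruling 2026-08-21T04:07:19Z): research routes; no claim beyond the stated classes;
census / instrument output is EVIDENCE, never a Literature fact; per-pair certificates are
INSTRUMENTATION (E4), never coverage. This file: PROVED bookkeeping theorems only (no definition,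
no named fact, net debt `0`), every one CONDITIONAL on exactly ONE typed input of the sibling
`QuadraticBranchOddStrictSelmer.lean` (`QuadraticBranchOddStrictSelmerBoundAt W p`, resp. its
image-free twin `QuadraticBranchOddStrictSelmerBoundOfPlusMCAt W p` — theorem-shaped assemblies of
Kobayashi 2003 Thm. 4.1 (odd, `η ≠ 1`) / Thm. 7.4 + Thm. 2.2 + Kitajima–Otsuki 2018 Main Thm. 1.3
+ Lemma 9.1, UNWRITTEN as assemblies; n1011-p17's row T-O7ss-P13 refines them into the READINGS of
`QuadraticBranchOddStrictSelmerReadings.lean`). Nothing is booked; no label of `RESIDUAL-MAP.md`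
moves; the classes served stay CONSTRUCTION-SHAPED / OPEN.

## What changed, and what is here

The consumers of `QuadraticBranchOddStrictSelmerCertificate.lean` (p261032, this seat GEN 5) take
TWO typed inputs: the bottom-layer bound (§3 of p259634) and the elementary (P4)
`StrictSelmerDominatesShaAt W p` (§4: in rank `≥ 1`, `#Ш(W)[p^∞] ∣ #Sel_str(W/ℚ)[p^∞]`). (P4) is now
a THEOREM of the tree for every elliptic `W/ℚ` and every prime `p` — n1011-p01 GEN 2,
`StrictSha.strictSelmerDominatesShaAt_holds` (p263878; the `ℤ_p`-structure of `E(ℚ_p)` + the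
restriction of `Ш` to the strict local condition, `StrictSelmerDominatesShaAlgebra.lean` /
`StrictSelmerDominatesSha.lean`). This file feeds it in, so each consumer loses one hypothesis:

* `padicValNat_card_shaPrimary_eq_zero_of_bound_of_rank` — bottom-layer bound + unit certificate +
  `rank ≥ 1` ⟹ `ord_p #Ш(W)[p^∞] = 0` (no `hL6`).
* `bsdp_of_oddStrictSelmerBound_of_unit'` — §3 input (surjective form) + certificates (i) `coeff₁
  L_p⁻(V, η, X) ∈ ℤ_p^×` and (ii) `ord_p #Ш(W)_an = 0` + `r_an(W) = 1` (GZK by name) ⟹ `BSD(W, p)`.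
* `bsdp_of_oddStrictSelmerBoundOfPlusMC_of_unit'` — the image-free twin on the §3′ input.
* `bsdp_of_oddBranchUnitCertificate'` — the packaged sub-class form (record ∧ surjectivity ∧ (ii)).

SCOPE unchanged (O10 class lead's RULING `class-closure/O10/RULING-ETA-ODD-STRICT-x1b.md`,
sha16 `a8bd8e04d6a47657`): an UPPER bound on `Ш`; NOT an O10 route; NEW only on O7-ss ∩ `e = 2` ∩
`r_an = 1` ∩ NON-CM (the O7 owners — cc-typer-2 / n1011 r = 1 strand — decide whether to take it).
This seat types no O7 class predicate.

References: [Kobayashi2003] Thm. 4.1 (p. 8), Thm. 7.4 (p. 13), Lemma 9.1 (p. 25);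
[GreenbergLNM1716] §2 pp. 62–63; [Miller2011LMS] §1, Def. 1.1; [Darmon2004] Thm. 3.22.
-/

noncomputable section

open scoped Classical MatrixGroups ModularForm

open CongruenceSubgroup Polynomial WeierstrassCurve Literature.NumberTheory.EllipticCurves
  Literature.NumberTheory.EllipticCurves.ModularForms
  Literature.NumberTheory.EllipticCurves.Kobayashi2003
  Literature.NumberTheory.EllipticCurves.Rank1Residual
  Literature.NumberTheory.EllipticCurves.Rank1Residual.Typed
  Literature.NumberTheory.GaloisRepresentations ZpExtension

namespace Summit.BirchSwinnertonDyer.Rank1Residual.Additive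

section Consumers

variable (W : WeierstrassCurve ℚ) [W.IsElliptic] [W.IsGloballyMinimal] (p : ℕ) [Fact p.Prime]

variable {W p}

omit [W.IsGloballyMinimal] in
/-- **Bottom-layer bound + unit certificate + `rank ≥ 1` ⟹ `p ∤ #Ш(W)[p^∞]`, with (P4) fed in.**
The bound gives `#Sel_str(W/ℚ)[p^∞]` finite of order prime to `p`; by the tree's theorem
`StrictSha.strictSelmerDominatesShaAt_holds` (in rank `≥ 1`, `#Ш(W)[p^∞] ∣ #Sel_str`) the
`p`-primary part of `Ш(W)` has order prime to `p`. Bookkeeping; no typed (P4) hypothesis.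
[cite: GreenbergLNM1716, §2 (pp. 62–63)] [cite: Kobayashi2003, Thm. 4.1 (p. 8)] -/
theorem padicValNat_card_shaPrimary_eq_zero_of_bound_of_rank {Lη : IwasawaAlgebra p}
    (hP : 1 ≤ W.mordellWeilRank)
    (hB : Finite ↥(strictSelmerPInfty W p) ∧
      (padicValNat p (Nat.card ↥(strictSelmerPInfty W p)) : ℤ) ≤
        ((PowerSeries.coeff 1 Lη : ℤ_[p]) : ℚ_[p]).valuation)
    (hunit : IsUnit (PowerSeries.coeff 1 Lη)) :
    padicValNat p (Nat.card (AddCommGroup.primaryComponent W.sha p)) = 0 :=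
  padicValNat_card_shaPrimary_eq_zero_of_bound (StrictSha.strictSelmerDominatesShaAt_holds W p) hP
    hB hunit

variable (W p)

/-- **END-TO-END, surjective form, ONE typed input (the VERBATIM-EXTENSION sub-class of O7-ss ∩
`e = 2`, non-CM):** granted GZK (`hGZK`), the typed input `QuadraticBranchOddStrictSelmerBoundAt W p`
(§3 of the sibling), a pair `(W, p)` with `W^{(p*)} ≅ V` good, `a_p(V) = 0`, `ρ_{V,p^∞}` onto, of
analytic rank one, carrying the TWO PER-PAIR CERTIFICATES (i) `coeff₁ L_p⁻(V, η, X) ∈ ℤ_p^×` and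
(ii) `ord_p #Ш(W)_an = 0`, satisfies Miller's **`BSD(W, p)`**. The elementary (P4) is supplied by
`StrictSha.strictSelmerDominatesShaAt_holds`. NO `p`-adic height, NO Schneider hypothesis, NO
Gross–Zagier formula on the branch. CONDITIONAL on the one typed input; nothing booked; no label
moves. [cite: Miller2011LMS, §1 and Def. 1.1] [cite: Darmon2004, Thm. 3.22]
[cite: Kobayashi2003, Thm. 4.1 (p. 8) and Lemma 9.1 (p. 25)] -/
theorem bsdp_of_oddStrictSelmerBound_of_unit'
    (hGZK : rank_eq_analyticRank_of_analyticRank_le_one)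
    (h : QuadraticBranchOddStrictSelmerBoundAt W p)
    {V : WeierstrassCurve ℚ} [V.IsElliptic] [V.IsGloballyMinimal] {C : VariableChange ℚ}
    {N : ℕ} [NeZero N] {f : CuspForm (Gamma0 N) 2} {ϖ : ℚ} {Lη : IwasawaAlgebra p}
    (hp : p ≠ 2) (hC : C • W.quadraticTwist ((-1) ^ (p / 2) * p) = V)
    (hgood : V.HasGoodReductionAtPrime p) (hap : V.frobeniusTrace p = 0)
    (hsurj : ∀ m : ℕ, V.HasSurjectiveModNGaloisRep (p ^ m : ℕ)) (hf : IsNewformOf V f)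
    (hϖ : if Even (p / 2) then (ϖ : ℝ) * V.realPeriodRat = plusPeriod f
        else (ϖ : ℝ) * V.imaginaryPeriodRat = minusPeriod f)
    (hL : IsQuadraticBranchMinusLFunction f p ϖ Lη) (hunit : IsUnit (PowerSeries.coeff 1 Lη))
    (hsha : ∃ q : ℚ, shaAn W = (q : ℂ) ∧ padicValRat p q = 0) (hr : W.analyticRank = 1) :
    BSDp W p :=
  bsdp_of_oddStrictSelmerBound_of_unit W p hGZK h (StrictSha.strictSelmerDominatesShaAt_holds W p)
    hp hC hgood hap hsurj hf hϖ hL hunit hsha hr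

/-- **END-TO-END, image-free (main-conjecture) form, ONE typed input:** the same with the image
hypothesis replaced by the sibling's typed (C1_η) `QuadraticBranchPlusMainConjectureAt V p` and the
§3′ input `QuadraticBranchOddStrictSelmerBoundOfPlusMCAt W p`; (P4) supplied by
`StrictSha.strictSelmerDominatesShaAt_holds`. By the O10 class lead's ruling this is NOT an O10
route; recorded for the NON-CM twins whose `p`-adic image is not onto. CONDITIONAL on the typed
§3′ input and (C1_η); nothing booked; no label moves.
[cite: Kobayashi2003, Thm. 7.4 (p. 13) and §4 (p. 8)] [cite: Miller2011LMS, §1 and Def. 1.1]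
[cite: Darmon2004, Thm. 3.22] -/
theorem bsdp_of_oddStrictSelmerBoundOfPlusMC_of_unit'
    (hGZK : rank_eq_analyticRank_of_analyticRank_le_one)
    (h : QuadraticBranchOddStrictSelmerBoundOfPlusMCAt W p)
    {V : WeierstrassCurve ℚ} [V.IsElliptic] [V.IsGloballyMinimal] {C : VariableChange ℚ}
    {N : ℕ} [NeZero N] {f : CuspForm (Gamma0 N) 2} {ϖ : ℚ} {Lη : IwasawaAlgebra p}
    (hp : p ≠ 2) (hC : C • W.quadraticTwist ((-1) ^ (p / 2) * p) = V)
    (hgood : V.HasGoodReductionAtPrime p) (hap : V.frobeniusTrace p = 0)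
    (hMC : QuadraticBranchPlusMainConjectureAt V p) (hf : IsNewformOf V f)
    (hϖ : if Even (p / 2) then (ϖ : ℝ) * V.realPeriodRat = plusPeriod f
        else (ϖ : ℝ) * V.imaginaryPeriodRat = minusPeriod f)
    (hL : IsQuadraticBranchMinusLFunction f p ϖ Lη) (hunit : IsUnit (PowerSeries.coeff 1 Lη))
    (hsha : ∃ q : ℚ, shaAn W = (q : ℂ) ∧ padicValRat p q = 0) (hr : W.analyticRank = 1) :
    BSDp W p :=
  bsdp_of_oddStrictSelmerBoundOfPlusMC_of_unit W p hGZK h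
    (StrictSha.strictSelmerDominatesShaAt_holds W p) hp hC hgood hap hMC hf hϖ hL hunit hsha hr

/-- **Sub-class form, ONE typed input (for obsanat / the O7 typer: census the predicate
`OddBranchUnitCertificateAt W p` ∧ `ρ_{V,p^∞}` onto ∧ `ord_p #Ш_an = 0` on `Additive.SubGss` rows
with `e = 2`, `r_an = 1`):** packaged version of `bsdp_of_oddStrictSelmerBound_of_unit'` with the
certificate record and surjectivity for the twist named by the record; (P4) supplied by
`StrictSha.strictSelmerDominatesShaAt_holds`. CONDITIONAL on the typed §3 input; nothing booked.
[cite: Kobayashi2003, Thm. 4.1 (p. 8)] [cite: Miller2011LMS, Def. 1.1] -/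
theorem bsdp_of_oddBranchUnitCertificate'
    (hGZK : rank_eq_analyticRank_of_analyticRank_le_one)
    (h : QuadraticBranchOddStrictSelmerBoundAt W p) (hp : p ≠ 2)
    (hcert : ∃ (V : WeierstrassCurve ℚ) (_ : V.IsElliptic) (_ : V.IsGloballyMinimal)
      (C : VariableChange ℚ) (N : ℕ) (_ : NeZero N) (f : CuspForm (Gamma0 N) 2) (ϖ : ℚ)
      (Lη : IwasawaAlgebra p),
      C • W.quadraticTwist ((-1) ^ (p / 2) * p) = V ∧
      V.HasGoodReductionAtPrime p ∧ V.frobeniusTrace p = 0 ∧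
      (∀ m : ℕ, V.HasSurjectiveModNGaloisRep (p ^ m : ℕ)) ∧ IsNewformOf V f ∧
      (if Even (p / 2) then (ϖ : ℝ) * V.realPeriodRat = plusPeriod f
          else (ϖ : ℝ) * V.imaginaryPeriodRat = minusPeriod f) ∧
      IsQuadraticBranchMinusLFunction f p ϖ Lη ∧ IsUnit (PowerSeries.coeff 1 Lη))
    (hsha : ∃ q : ℚ, shaAn W = (q : ℂ) ∧ padicValRat p q = 0) (hr : W.analyticRank = 1) :
    BSDp W p :=
  bsdp_of_oddBranchUnitCertificate W p hGZK h (StrictSha.strictSelmerDominatesShaAt_holds W p) hp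
    hcert hsha hr

end Consumers

end Summit.BirchSwinnertonDyer.Rank1Residual.Additive

end
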